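import Literature.Analysis.FluidPDE.HouLiSpaceTime
import Literature.Analysis.FluidPDE.ClassicalSolutionCalculus
import HarnessLib

/-!
# SHEET LAWS (ROUND-21 of nsreg-p2), engine objects: the reflection through the sheet, the
# coordinate swap `x₀ ↔ x₂`, and the Hadamard quotient by the height `zQuot w = w / x₂`

Prover seat nsreg-p4 (gen 14), line material of the route `SwirlThreshold`
(`--supports stmt-NavierStokesRegularity-2002`).  Objects used by the proof of the support statement
S-21.1 `SheetLaws.OddContrastMaxPrinciple` (maximum principle for the odd contrast `χ = Γ/z`):

* `reflZ` (`(x₀,x₁,x₂) ↦ (x₀,x₁,-x₂)`) and `swap02` (`(x₀,x₁,x₂) ↦ (x₂,x₁,x₀)`) with their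
  continuous-linear versions `reflZL`, `swap02L` (for chain rules);
* `zQuot w x = ∫₀¹ ∂₂w(x₀, x₁, σ x₂) dσ` — **Hadamard's quotient by the third coordinate**, realised as
  the tree's first-coordinate quotient `hadamardQuotFst` (`HadamardQuotient.lean`) transported through
  `swap02`: `x₂ · zQuot w x = w x` for `w ∈ C¹` vanishing on the sheet `{x₂ = 0}` (`mul_zQuot`),
  `w ∈ Cⁿ⁺¹ ⇒ zQuot w ∈ Cⁿ` (`contDiff_zQuot`), ON the sheet `zQuot w = ∂₂w` (`zQuot_of_sheet`), and
  the quotient of a jointly smooth family is jointly smooth (`IsSmoothSpaceTimeOn.zQuot_family`, from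
  the tree's `IsSmoothSpaceTimeOn.hadamardQuotFst_family`).

The definitions `reflZ`, `swap02`, `zQuot` and the lemmas `mul_zQuot`, `contDiff_zQuot`,
`contDiff_swap02` are taken over from the planner's s21-3 skeleton
(`HOME/ns-regularity-ideate-p2/R21-S211-skeleton.lean`, nsreg-p2 g23, step (1) of its proof plan).

WHAT THIS IS NOT: calculus only; nothing here is a statement about Navier–Stokes.
-/

namespace Summit.NavierStokesRegularity.NavierStokesRegularity.Theorems.SheetLaws

open MeasureTheory Set Filter Topology Metric WithLp Function
open scoped ContDiff
open Literature.Analysis Literature.Analysis.FluidPDE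

noncomputable section

/-! ## The reflection through the sheet `{x₂ = 0}` -/

/-- The reflection through the sheet `{x₂ = 0}`: `(x₀, x₁, x₂) ↦ (x₀, x₁, -x₂)`. -/
def reflZ (x : EuclideanSpace ℝ (Fin 3)) : EuclideanSpace ℝ (Fin 3) := toLp 2 ![x 0, x 1, -x 2]

/-- `(reflZ x)₀ = x₀`. -/
@[simp] theorem reflZ_apply_zero (x : EuclideanSpace ℝ (Fin 3)) : reflZ x 0 = x 0 := by
  simp [reflZ]

/-- `(reflZ x)₁ = x₁`. -/
@[simp] theorem reflZ_apply_one (x : EuclideanSpace ℝ (Fin 3)) : reflZ x 1 = x 1 := by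
  simp [reflZ]

/-- `(reflZ x)₂ = -x₂`. -/
@[simp] theorem reflZ_apply_two (x : EuclideanSpace ℝ (Fin 3)) : reflZ x 2 = -x 2 := by
  simp [reflZ]

/-- Sheet points are fixed by the reflection. -/
theorem reflZ_eq_self_of_sheet {x : EuclideanSpace ℝ (Fin 3)} (hx : x 2 = 0) : reflZ x = x := by
  ext i; fin_cases i <;> simp [reflZ, hx]

/-- `reflZ` is an involution. -/
@[simp] theorem reflZ_reflZ (x : EuclideanSpace ℝ (Fin 3)) : reflZ (reflZ x) = x := by
  ext i; fin_cases i <;> simp [reflZ]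

/-- The reflection through the sheet as a linear map. -/
def reflZₗ : EuclideanSpace ℝ (Fin 3) →ₗ[ℝ] EuclideanSpace ℝ (Fin 3) where
  toFun := reflZ
  map_add' x y := by
    ext i; fin_cases i <;> simp [reflZ]
    ring
  map_smul' c x := by ext i; fin_cases i <;> simp [reflZ]

/-- The reflection through the sheet as a continuous linear map (for chain rules). -/
def reflZL : EuclideanSpace ℝ (Fin 3) →L[ℝ] EuclideanSpace ℝ (Fin 3) :=
  LinearMap.toContinuousLinearMap reflZₗ

/-- `reflZL` is `reflZ`. -/
@[simp] theorem reflZL_apply (x : EuclideanSpace ℝ (Fin 3)) : reflZL x = reflZ x := rfl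

/-- `reflZ` has derivative `reflZL` everywhere. -/
theorem hasFDerivAt_reflZ (x : EuclideanSpace ℝ (Fin 3)) : HasFDerivAt reflZ reflZL x := by
  have h : (reflZL : EuclideanSpace ℝ (Fin 3) → EuclideanSpace ℝ (Fin 3)) = reflZ := rfl
  rw [← h]
  exact reflZL.hasFDerivAt

/-- `reflZ` is smooth. -/
theorem contDiff_reflZ {n : WithTop ℕ∞} : ContDiff ℝ n reflZ := by
  have h : (reflZL : EuclideanSpace ℝ (Fin 3) → EuclideanSpace ℝ (Fin 3)) = reflZ := rfl
  rw [← h]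
  exact reflZL.contDiff

/-- `reflZ e₂ = -e₂`. -/
theorem reflZ_single_two :
    reflZ (EuclideanSpace.single (2 : Fin 3) (1 : ℝ)) = -EuclideanSpace.single (2 : Fin 3) (1 : ℝ) := by
  ext i; fin_cases i <;> simp [reflZ]

/-! ## The coordinate swap `x₀ ↔ x₂` -/

/-- Swap of the first and third coordinates `(x₀, x₁, x₂) ↦ (x₂, x₁, x₀)`. -/
def swap02 (x : EuclideanSpace ℝ (Fin 3)) : EuclideanSpace ℝ (Fin 3) := toLp 2 ![x 2, x 1, x 0]

/-- `(swap02 x)₀ = x₂`. -/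
@[simp] theorem swap02_apply_zero (x : EuclideanSpace ℝ (Fin 3)) : swap02 x 0 = x 2 := by
  simp [swap02]

/-- `(swap02 x)₁ = x₁`. -/
@[simp] theorem swap02_apply_one (x : EuclideanSpace ℝ (Fin 3)) : swap02 x 1 = x 1 := by
  simp [swap02]

/-- `(swap02 x)₂ = x₀`. -/
@[simp] theorem swap02_apply_two (x : EuclideanSpace ℝ (Fin 3)) : swap02 x 2 = x 0 := by
  simp [swap02]

/-- `swap02` is an involution. -/
@[simp] theorem swap02_swap02 (x : EuclideanSpace ℝ (Fin 3)) : swap02 (swap02 x) = x := by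
  ext i; fin_cases i <;> simp [swap02]

/-- The coordinate swap as a linear map. -/
def swap02ₗ : EuclideanSpace ℝ (Fin 3) →ₗ[ℝ] EuclideanSpace ℝ (Fin 3) where
  toFun := swap02
  map_add' x y := by ext i; fin_cases i <;> simp [swap02]
  map_smul' c x := by ext i; fin_cases i <;> simp [swap02]

/-- The coordinate swap as a continuous linear map (for chain rules). -/
def swap02L : EuclideanSpace ℝ (Fin 3) →L[ℝ] EuclideanSpace ℝ (Fin 3) :=
  LinearMap.toContinuousLinearMap swap02ₗ

/-- `swap02L` is `swap02`. -/
@[simp] theorem swap02L_apply (x : EuclideanSpace ℝ (Fin 3)) : swap02L x = swap02 x := rfl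

/-- `swap02` has derivative `swap02L` everywhere. -/
theorem hasFDerivAt_swap02 (x : EuclideanSpace ℝ (Fin 3)) : HasFDerivAt swap02 swap02L x := by
  have h : (swap02L : EuclideanSpace ℝ (Fin 3) → EuclideanSpace ℝ (Fin 3)) = swap02 := rfl
  rw [← h]
  exact swap02L.hasFDerivAt

/-- `swap02` is smooth. -/
theorem contDiff_swap02 {n : WithTop ℕ∞} : ContDiff ℝ n swap02 := by
  have h : (swap02L : EuclideanSpace ℝ (Fin 3) → EuclideanSpace ℝ (Fin 3)) = swap02 := rfl
  rw [← h]
  exact swap02L.contDiff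

/-- `swap02 e₀ = e₂`. -/
theorem swap02_single_zero :
    swap02 (EuclideanSpace.single (0 : Fin 3) (1 : ℝ)) = EuclideanSpace.single (2 : Fin 3) (1 : ℝ) := by
  ext i; fin_cases i <;> simp [swap02]

/-! ## The Hadamard quotient by the height -/

/-- **Hadamard quotient by the third coordinate**: `zQuot w x = ∫₀¹ ∂₂w(x₀, x₁, σ x₂) dσ`, realised
as the tree's `hadamardQuotFst` of `w ∘ swap02` at `swap02 x`.  For `w ∈ C¹` vanishing on the sheet
this is the continuous quotient `w / x₂` (`mul_zQuot`), smooth across the sheet (`contDiff_zQuot`). -/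
def zQuot (w : EuclideanSpace ℝ (Fin 3) → ℝ) (x : EuclideanSpace ℝ (Fin 3)) : ℝ :=
  hadamardQuotFst (fun y => w (swap02 y)) (swap02 x)

/-- **Hadamard's lemma in `z`**: `x₂ · zQuot w x = w x` for `w ∈ C¹` vanishing on the sheet. -/
theorem mul_zQuot {w : EuclideanSpace ℝ (Fin 3) → ℝ} (hw : ContDiff ℝ 1 w)
    (h0 : ∀ x : EuclideanSpace ℝ (Fin 3), x 2 = 0 → w x = 0) (x : EuclideanSpace ℝ (Fin 3)) :
    x 2 * zQuot w x = w x := by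
  have h1 : ContDiff ℝ 1 fun y => w (swap02 y) := hw.comp contDiff_swap02
  have h2 : ∀ y : EuclideanSpace ℝ (Fin 3), y 0 = 0 → w (swap02 y) = 0 :=
    fun y hy => h0 _ (by simpa using hy)
  have h := smul_hadamardQuotFst h1 h2 (swap02 x)
  simp only [smul_eq_mul, swap02_apply_zero, swap02_swap02] at h
  simpa [zQuot] using h

/-- Off the sheet the Hadamard quotient IS the quotient: `zQuot w x = w x / x₂`. -/
theorem zQuot_eq_div {w : EuclideanSpace ℝ (Fin 3) → ℝ} (hw : ContDiff ℝ 1 w)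
    (h0 : ∀ x : EuclideanSpace ℝ (Fin 3), x 2 = 0 → w x = 0) {x : EuclideanSpace ℝ (Fin 3)}
    (hx : x 2 ≠ 0) : zQuot w x = w x / x 2 := by
  rw [eq_div_iff hx, mul_comm]
  exact mul_zQuot hw h0 x

/-- `w ∈ Cⁿ⁺¹ ⇒ zQuot w ∈ Cⁿ` (globally, across the sheet). -/
theorem contDiff_zQuot {w : EuclideanSpace ℝ (Fin 3) → ℝ} {n : ℕ∞} (hw : ContDiff ℝ (n + 1) w) :
    ContDiff ℝ n (zQuot w) :=
  (contDiff_hadamardQuotFst (hw.comp contDiff_swap02)).comp contDiff_swap02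

/-- The tree's first-coordinate Hadamard quotient ON the plane `{y₀ = 0}` is the first partial
derivative: `hadamardQuotFst w y = ∂₀w(y)` (the integrand `∂₀w(s y₀, y₁, y₂)` is constant in `s`). -/
theorem hadamardQuotFst_of_apply_zero {w : EuclideanSpace ℝ (Fin 3) → ℝ} {y : EuclideanSpace ℝ (Fin 3)}
    (hy : y 0 = 0) : hadamardQuotFst w y = fderiv ℝ w y (EuclideanSpace.single 0 1) := by
  have hs : ∀ s : ℝ, scaleFst s y = y := fun s => by
    simp [scaleFst, hy]
  simp only [hadamardQuotFst, hs, intervalIntegral.integral_const, sub_zero, one_smul]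

/-- **On the sheet the Hadamard quotient is the vertical derivative**: `zQuot w x = ∂₂w(x)` at every
`x` with `x₂ = 0`, for `w` differentiable at `x`. -/
theorem zQuot_of_sheet {w : EuclideanSpace ℝ (Fin 3) → ℝ} {x : EuclideanSpace ℝ (Fin 3)}
    (hw : DifferentiableAt ℝ w x) (hx : x 2 = 0) :
    zQuot w x = fderiv ℝ w x (EuclideanSpace.single 2 1) := by
  have h0 : swap02 x 0 = 0 := by simpa using hx
  rw [zQuot, hadamardQuotFst_of_apply_zero h0]
  have hc : HasFDerivAt (fun y => w (swap02 y)) ((fderiv ℝ w x).comp swap02L) (swap02 x) := by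
    have h1 : HasFDerivAt w (fderiv ℝ w x) (swap02 (swap02 x)) := by
      rw [swap02_swap02]; exact hw.hasFDerivAt
    exact h1.comp (swap02 x) (hasFDerivAt_swap02 (swap02 x))
  rw [hc.fderiv, ContinuousLinearMap.comp_apply, swap02L_apply, swap02_single_zero]

/-- `zQuot` is linear in `w`: constant multiples. -/
theorem zQuot_const_mul {w : EuclideanSpace ℝ (Fin 3) → ℝ} (hw : ContDiff ℝ 1 w) (a : ℝ)
    (x : EuclideanSpace ℝ (Fin 3)) : zQuot (fun y => a * w y) x = a * zQuot w x := by
  have hd : ∀ y, DifferentiableAt ℝ (fun y => w (swap02 y)) y := fun y =>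
    ((hw.comp contDiff_swap02).differentiable one_ne_zero) y
  simp only [zQuot, hadamardQuotFst]
  have h1 : ∀ s : ℝ, fderiv ℝ (fun y => a * w (swap02 y)) (scaleFst s (swap02 x))
      (EuclideanSpace.single 0 1) =
      a * fderiv ℝ (fun y => w (swap02 y)) (scaleFst s (swap02 x)) (EuclideanSpace.single 0 1) := by
    intro s
    rw [fderiv_const_mul (hd _)]
    simp
  simp_rw [h1]
  exact intervalIntegral.integral_const_mul a _

/-! ## Jointly smooth families -/

section Family

variable {S : Set ℝ} {F : ℝ → EuclideanSpace ℝ (Fin 3) → ℝ}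

/-- Composing a jointly smooth scalar family with the coordinate swap in space keeps it jointly
smooth. -/
theorem IsSmoothSpaceTimeOn.comp_swap02 (hF : IsSmoothSpaceTimeOn S F) :
    IsSmoothSpaceTimeOn S fun t y => F t (swap02 y) := by
  have hA : ContDiff ℝ ∞ fun p : ℝ × EuclideanSpace ℝ (Fin 3) => ((p.1, swap02 p.2) : ℝ × _) :=
    contDiff_fst.prodMk (contDiff_swap02.comp contDiff_snd)
  have hmaps : MapsTo (fun p : ℝ × EuclideanSpace ℝ (Fin 3) => ((p.1, swap02 p.2) : ℝ × _))
      (S ×ˢ (univ : Set (EuclideanSpace ℝ (Fin 3)))) (S ×ˢ univ) :=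
    fun p hp => ⟨(mem_prod.1 hp).1, mem_univ _⟩
  have h : ContDiffOn ℝ ∞ (uncurry F ∘ fun p : ℝ × EuclideanSpace ℝ (Fin 3) =>
      ((p.1, swap02 p.2) : ℝ × _)) (S ×ˢ univ) :=
    ContDiffOn.comp hF hA.contDiffOn hmaps
  exact h

/-- **The Hadamard quotient by the height of a jointly smooth family is jointly smooth** on
`S × ℝ³` (`S` convex, of unique differentiability): from the tree's
`IsSmoothSpaceTimeOn.hadamardQuotFst_family` through `swap02`. -/
theorem IsSmoothSpaceTimeOn.zQuot_family (hF : IsSmoothSpaceTimeOn S F) (hc : Convex ℝ S)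
    (hS : UniqueDiffOn ℝ S) : IsSmoothSpaceTimeOn S fun t => zQuot (F t) := by
  have h1 : IsSmoothSpaceTimeOn S fun t => hadamardQuotFst (fun y => F t (swap02 y)) :=
    (IsSmoothSpaceTimeOn.comp_swap02 hF).hadamardQuotFst_family hc hS
  exact IsSmoothSpaceTimeOn.comp_swap02 h1

end Family

end

end Summit.NavierStokesRegularity.NavierStokesRegularity.Theorems.SheetLaws
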